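/-
Copyright: the b2b-balaban T⁴-continuum CRUX team, row NE7b OWNER lineage `t4-ne7b-p1` (gen 107). Project licence.
-/
import Summits.QuantumFields.BalabanUV.T4Continuum.Spine.NE7b.ConvexTiltSuppliers
import Mathlib.Analysis.Calculus.MeanValue

/-!
# SUPPLIERS OF THE CONVEXITY LETTER ON A WINDOW: a Hessian bound ON a convex `K` gives the first-order letter ON `K`; a coercive
# quadratic form plus a perturbation with `‖D³P‖ ≤ c₃` on `K ⊆ B̄(0,ρ)` and `D²P(0) = 0` is `(2σ − c₃ρ)`-uniformly convex ON `K` —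
# «the window is small, so the anharmonic Hessian is small» as kernel lemmas (row NE7b, node U5c; letter (ℓ1) of the windowed road)

Cell `pub-balaban`, sub-cell `t4`, spine estimate NE7b (`T4WeightBudget.RelWeightBound`; the cell's OWN estimate — NOT PRINTED in
[Bałaban 1983–89], NOT PROVED).  Crux-route work under `Spine/NE7b/` by the row's OWNER; NOTHING of Bałaban's is named or asserted;
no `T4Continuum/Support` leaf typed; no `def`; zero `sorry`.

WHY.  The windowed convexity road (`…NE7b.ConvexWindowTiltMoment`, σ-ne7bref-g68-2 as a theorem) asks the first-order `λ`-letter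
BETWEEN POINTS OF THE WINDOW `K` only; the refuter's bill for family (2) (PRICING-NE7b v84 F443: «the windowed road's print-side bill
shrinks to {λ on K by value; (A3)}») leaves the modulus `λ` ON `K` as the one analytic letter.  `…NE7b.ConvexTiltSuppliers` (gen 106)
supplies it on the WHOLE carrier (`2σ − h` from a coercive quadratic form and a GLOBAL Hessian bound `D²P ≥ −h`).  On a window the
mechanism is sharper and is print's own («small Hessian `≲ C·ε_k`», refuter F388 ∕ κ-ne7bref-g67-5 (2)): the anharmonic remainder `P`
of the action about its expansion point has `D²P(0) = 0` and a bounded THIRD derivative, so `‖D²P(x)‖ ≤ c₃‖x‖ ≤ c₃ρ` on a window of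
radius `ρ` — by the mean value inequality ON THE CONVEX WINDOW — and the full exponent `⟪x,Ax⟫ + P` is `(2σ − c₃ρ)`-uniformly convex ON
`K`, positive as soon as `c₃ρ < 2σ`.  THIS FILE types that supplier chain with every hypothesis asked ON `K` ONLY.

WHAT IS PROVED ([folklore] calculus on `EuclideanSpace ℝ (Fin n)`; the tree's segment lemmas and Mathlib's mean value inequality):
* §1 **`firstOrderOn_of_hessianOn_lower`**: `K` convex, `Φ ∈ C²`, `κ‖v‖² ≤ D²Φ(x)[v,v]` for `x ∈ K` (any sign of `κ`) ⟹ the first-order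
  `κ`-letter between points of `K` (the tree's two monotonicity steps, run on `[0,1]` only).
* §2 `firstOrderOn_add` (moduli add ON `K`), `firstOrderOn_quadratic_add` (`⟪x,Ax⟫ + P`, `A` symmetric `σ`-coercive, `P` semiconvex ON
  `K` ⟹ modulus `2σ − h` ON `K`), `firstOrderOn_quadratic_add_of_hessianOn` (the same from `D²P ≥ −h` ON `K`).
* §3 **`norm_hessian_le_of_thirdDeriv_le`** (`K` convex, `0 ∈ K ⊆ B̄(0,ρ)`, `P ∈ C³`, `‖D³P‖ ≤ c₃` on `K` ⟹ `‖D²P(x)‖ ≤ ‖D²P(0)‖ + c₃ρ` on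
  `K`), `hessianOn_lower_of_thirdDeriv_le` (`D²P(x)[v,v] ≥ −(‖D²P(0)‖ + c₃ρ)‖v‖²`), and the END
  **`firstOrderOn_quadratic_add_of_thirdDeriv`**: modulus `2σ − (‖D²P(0)‖ + c₃ρ)` ON `K` — `= 2σ − c₃ρ` when `D²P(0) = 0`.

NOT HERE (honest): the three numbers `σ` (coercivity of print's fluctuation covariance), `c₃` (third derivative of print's effective
action on the window) and `ρ` (the window's chart radius) for Bałaban's steps — (A3) readings, the by-value content of Q-ne7bref-g68-1;
anything of Bałaban's.  NE7b NOT PRINTED ∕ NOT PROVED; spine PROVED 0∕9; rung (B)+1 on a FINITE torus — NOT infinite volume, NOT the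
mass gap, NOT Clay.
HONEST DEPENDENCY: continuum YM on T⁴ ⇐ BetaPertH ∧ nine spine estimates (0/9 proved); BetaPertH ⇐ (D1) ∧ (D4) ∧ CAP+tail.
-/

set_option autoImplicit false

noncomputable section

open Real InnerProductSpace Set Metric
open scoped RealInnerProductSpace Gradient
open Literature.Analysis.FunctionSpaces
open Summit.QuantumFields.BalabanUV.T4Continuum.NE7b.ConvexTiltSuppliers

namespace Summit.QuantumFields.BalabanUV.T4Continuum.NE7b.ConvexWindowSuppliers

variable {n : ℕ}

/-! ## §1 Hessian lower bound ON a convex window ⟹ the first-order letter ON the window -/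

/-- **SECOND-ORDER ⟹ FIRST-ORDER, ON A CONVEX WINDOW.**  If `K` is convex, `Φ ∈ C²` and `κ‖v‖² ≤ D²Φ(x)[v, v]` for all `x ∈ K` and
all `v` (any sign of `κ`), then `Φ x + ⟪∇Φ x, y − x⟫ + (κ∕2)‖y − x‖² ≤ Φ y` for all `x, y ∈ K`.  Along the segment `θ ↦ x + θ(y − x)`,
which stays in `K` for `θ ∈ [0,1]`, by two monotonicity steps on `[0,1]`. [folklore] -/
theorem firstOrderOn_of_hessianOn_lower {Φ : EuclideanSpace ℝ (Fin n) → ℝ} {κ : ℝ} {K : Set (EuclideanSpace ℝ (Fin n))}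
    (hK : Convex ℝ K) (hΦ : ContDiff ℝ 2 Φ)
    (hH : ∀ x ∈ K, ∀ v : EuclideanSpace ℝ (Fin n), κ * ‖v‖ ^ 2 ≤ iteratedFDeriv ℝ 2 Φ x ![v, v]) :
    ∀ x ∈ K, ∀ y ∈ K, Φ x + ⟪gradient Φ x, y - x⟫ + κ / 2 * ‖y - x‖ ^ 2 ≤ Φ y := by
  intro x hx y hy
  set ξ : EuclideanSpace ℝ (Fin n) := y - x with hξ
  have hΦd : Differentiable ℝ Φ := hΦ.differentiable (by norm_num)
  have hseg : ∀ θ ∈ Icc (0 : ℝ) 1, x + θ • ξ ∈ K := fun θ hθ =>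
    hK.add_smul_mem hx (by rw [hξ, add_sub_cancel]; exact hy) hθ
  -- the restriction to the segment and its first two derivatives
  set g : ℝ → ℝ := fun θ => Φ (x + θ • ξ) with hg
  set g' : ℝ → ℝ := fun θ => fderiv ℝ Φ (x + θ • ξ) ξ with hg'
  set g'' : ℝ → ℝ := fun θ => fderiv ℝ (fderiv ℝ Φ) (x + θ • ξ) ξ ξ with hg''
  have hg1 : ∀ θ, HasDerivAt g (g' θ) θ := fun θ =>
    Literature.Analysis.Calculus.hasDerivAt_comp_lineSegment hΦd x ξ θ
  have hg2 : ∀ θ, HasDerivAt g' (g'' θ) θ := fun θ =>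
    Literature.Analysis.Calculus.hasDerivAt_fderiv_comp_lineSegment hΦ x ξ θ
  have hg2low : ∀ θ ∈ Icc (0 : ℝ) 1, κ * ‖ξ‖ ^ 2 ≤ g'' θ := fun θ hθ => by
    have := hH (x + θ • ξ) (hseg θ hθ) ξ
    rwa [iteratedFDeriv_two_apply] at this
  -- the auxiliary function `φ` and its derivative `φ'`
  set φ : ℝ → ℝ := fun θ => g θ - g 0 - θ * g' 0 - κ / 2 * θ ^ 2 * ‖ξ‖ ^ 2 with hφ
  set φ' : ℝ → ℝ := fun θ => g' θ - g' 0 - κ * θ * ‖ξ‖ ^ 2 with hφ'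
  have hφd : ∀ θ, HasDerivAt φ (φ' θ) θ := fun θ => by
    have h2 : HasDerivAt (fun θ' : ℝ => θ' * g' 0) (g' 0) θ := by
      simpa using (hasDerivAt_id θ).mul_const (g' 0)
    have h3 : HasDerivAt (fun θ' : ℝ => κ / 2 * θ' ^ 2 * ‖ξ‖ ^ 2) (κ * θ * ‖ξ‖ ^ 2) θ := by
      have := ((hasDerivAt_pow 2 θ).const_mul (κ / 2)).mul_const (‖ξ‖ ^ 2)
      refine this.congr_deriv ?_
      simp only [Nat.cast_ofNat, Nat.add_one_sub_one, pow_one]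
      ring
    exact ((((hg1 θ).sub_const (g 0)).sub h2).sub h3).congr_deriv (by simp [hφ'])
  have hφ'd : ∀ θ, HasDerivAt φ' (g'' θ - κ * ‖ξ‖ ^ 2) θ := fun θ => by
    have h3 : HasDerivAt (fun θ' : ℝ => κ * θ' * ‖ξ‖ ^ 2) (κ * ‖ξ‖ ^ 2) θ := by
      simpa using ((hasDerivAt_id θ).const_mul κ).mul_const (‖ξ‖ ^ 2)
    exact ((hg2 θ).sub_const (g' 0)).sub h3
  -- `φ'` is monotone ON `[0,1]` with `φ' 0 = 0`, so `φ' ≥ 0` there; hence `φ` is monotone ON `[0,1]`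
  have hφ'mono : MonotoneOn φ' (Icc 0 1) := by
    refine monotoneOn_of_deriv_nonneg (convex_Icc 0 1)
      (fun θ _ => (hφ'd θ).continuousAt.continuousWithinAt)
      (fun θ _ => (hφ'd θ).differentiableAt.differentiableWithinAt) fun θ hθ => ?_
    rw [interior_Icc] at hθ
    rw [(hφ'd θ).deriv]
    linarith [hg2low θ ⟨hθ.1.le, hθ.2.le⟩]
  have hφ'nonneg : ∀ θ ∈ Icc (0 : ℝ) 1, 0 ≤ φ' θ := fun θ hθ => by
    have h0 : φ' 0 = 0 := by simp [hφ']
    rw [← h0]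
    exact hφ'mono (left_mem_Icc.2 zero_le_one) hθ hθ.1
  have hφmono : MonotoneOn φ (Icc 0 1) := by
    refine monotoneOn_of_deriv_nonneg (convex_Icc 0 1)
      (fun θ _ => (hφd θ).continuousAt.continuousWithinAt)
      (fun θ _ => (hφd θ).differentiableAt.differentiableWithinAt) fun θ hθ => ?_
    rw [interior_Icc] at hθ
    rw [(hφd θ).deriv]
    exact hφ'nonneg θ ⟨hθ.1.le, hθ.2.le⟩
  have hφ1 : 0 ≤ φ 1 := by
    have h0 : φ 0 = 0 := by simp [hφ]
    rw [← h0]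
    exact hφmono (left_mem_Icc.2 zero_le_one) (right_mem_Icc.2 zero_le_one) zero_le_one
  -- unfold at `θ = 1`
  simp only [hφ, hg, hg', one_smul, zero_smul, add_zero, one_mul, one_pow, mul_one] at hφ1
  have hy' : x + ξ = y := by rw [hξ]; abel
  rw [hy'] at hφ1
  rw [inner_gradient_left]
  linarith

/-! ## §2 Additivity and the coercive quadratic form, ON the window -/

/-- **MODULI ADD ON A WINDOW**: first-order letters ON `K` with moduli `l₁`, `l₂` (any signs) for differentiable `V₁`, `V₂` give the letter
ON `K` with modulus `l₁ + l₂` for `V₁ + V₂`. [folklore] -/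
theorem firstOrderOn_add {V₁ V₂ : EuclideanSpace ℝ (Fin n) → ℝ} {l₁ l₂ : ℝ} {K : Set (EuclideanSpace ℝ (Fin n))}
    (h₁ : Differentiable ℝ V₁) (h₂ : Differentiable ℝ V₂)
    (hV₁ : ∀ x ∈ K, ∀ y ∈ K, V₁ x + ⟪gradient V₁ x, y - x⟫ + l₁ / 2 * ‖y - x‖ ^ 2 ≤ V₁ y)
    (hV₂ : ∀ x ∈ K, ∀ y ∈ K, V₂ x + ⟪gradient V₂ x, y - x⟫ + l₂ / 2 * ‖y - x‖ ^ 2 ≤ V₂ y) :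
    ∀ x ∈ K, ∀ y ∈ K,
      (V₁ x + V₂ x) + ⟪gradient (fun z => V₁ z + V₂ z) x, y - x⟫ + (l₁ + l₂) / 2 * ‖y - x‖ ^ 2 ≤ V₁ y + V₂ y := by
  intro x hx y hy
  have hg : gradient (fun z => V₁ z + V₂ z) x = gradient V₁ x + gradient V₂ x := by
    have e1 := (h₁ x).hasGradientAt
    have e2 := (h₂ x).hasGradientAt
    rw [hasGradientAt_iff_hasFDerivAt] at e1 e2
    have e12 := e1.add e2
    rw [← map_add] at e12
    exact (hasGradientAt_of_hasFDerivAt_toDual e12).gradient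
  rw [hg, inner_add_left]
  have a := hV₁ x hx y hy
  have b := hV₂ x hx y hy
  linarith

/-- **COERCIVE QUADRATIC FORM PLUS A PERTURBATION SEMICONVEX ON THE WINDOW**: `⟪v, Av⟫ ≥ σ‖v‖²` (`A` symmetric), `P` differentiable with
first-order modulus `−h` ON `K` ⟹ `⟪·, A·⟫ + P` has modulus `2σ − h` ON `K`. [folklore] -/
theorem firstOrderOn_quadratic_add (A : EuclideanSpace ℝ (Fin n) →L[ℝ] EuclideanSpace ℝ (Fin n)) {σ h : ℝ}
    {K : Set (EuclideanSpace ℝ (Fin n))} (hA : ∀ v w : EuclideanSpace ℝ (Fin n), ⟪A v, w⟫ = ⟪v, A w⟫)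
    (hσ : ∀ v : EuclideanSpace ℝ (Fin n), σ * ‖v‖ ^ 2 ≤ ⟪v, A v⟫) {P : EuclideanSpace ℝ (Fin n) → ℝ} (hP : Differentiable ℝ P)
    (hPsc : ∀ x ∈ K, ∀ y ∈ K, P x + ⟪gradient P x, y - x⟫ + (-h) / 2 * ‖y - x‖ ^ 2 ≤ P y) :
    ∀ x ∈ K, ∀ y ∈ K, (⟪x, A x⟫ + P x) + ⟪gradient (fun z : EuclideanSpace ℝ (Fin n) => ⟪z, A z⟫ + P z) x, y - x⟫ +
        (2 * σ - h) / 2 * ‖y - x‖ ^ 2 ≤ ⟪y, A y⟫ + P y := by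
  intro x hx y hy
  have := firstOrderOn_add (K := K) (differentiable_quadratic A hA) hP (fun x _ y _ => firstOrder_quadratic A hA hσ x y) hPsc
    x hx y hy
  have e : (2 * σ + -h) / 2 = (2 * σ - h) / 2 := by ring
  rw [e] at this
  exact this

/-- **«HESSIAN-SMALL ON THE WINDOW ⇒ UNIFORMLY CONVEX ON THE WINDOW»**: the same with `P ∈ C²` and `D²P(x)[v, v] ≥ −h‖v‖²` for
`x ∈ K` only (`K` convex). [folklore] -/
theorem firstOrderOn_quadratic_add_of_hessianOn (A : EuclideanSpace ℝ (Fin n) →L[ℝ] EuclideanSpace ℝ (Fin n)) {σ h : ℝ}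
    {K : Set (EuclideanSpace ℝ (Fin n))} (hK : Convex ℝ K) (hA : ∀ v w : EuclideanSpace ℝ (Fin n), ⟪A v, w⟫ = ⟪v, A w⟫)
    (hσ : ∀ v : EuclideanSpace ℝ (Fin n), σ * ‖v‖ ^ 2 ≤ ⟪v, A v⟫) {P : EuclideanSpace ℝ (Fin n) → ℝ} (hP : ContDiff ℝ 2 P)
    (hH : ∀ x ∈ K, ∀ v : EuclideanSpace ℝ (Fin n), -h * ‖v‖ ^ 2 ≤ iteratedFDeriv ℝ 2 P x ![v, v]) :
    ∀ x ∈ K, ∀ y ∈ K, (⟪x, A x⟫ + P x) + ⟪gradient (fun z : EuclideanSpace ℝ (Fin n) => ⟪z, A z⟫ + P z) x, y - x⟫ +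
        (2 * σ - h) / 2 * ‖y - x‖ ^ 2 ≤ ⟪y, A y⟫ + P y :=
  firstOrderOn_quadratic_add A hA hσ (hP.differentiable (by norm_num)) (firstOrderOn_of_hessianOn_lower hK hP hH)

/-! ## §3 The window is small ⟹ the anharmonic Hessian is small: a third-derivative bound on `K ⊆ B̄(0,ρ)` -/

/-- **MEAN VALUE FOR THE HESSIAN ON THE WINDOW**: `K` convex with `0 ∈ K ⊆ B̄(0, ρ)`, `P ∈ C³` with `‖D³P(x)‖ ≤ c₃` for `x ∈ K` ⟹
`‖D²P(x)‖ ≤ ‖D²P(0)‖ + c₃·ρ` for `x ∈ K`. [folklore] -/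
theorem norm_hessian_le_of_thirdDeriv_le {P : EuclideanSpace ℝ (Fin n) → ℝ} {c₃ ρ : ℝ} {K : Set (EuclideanSpace ℝ (Fin n))}
    (hK : Convex ℝ K) (h0 : (0 : EuclideanSpace ℝ (Fin n)) ∈ K) (hKρ : K ⊆ closedBall (0 : EuclideanSpace ℝ (Fin n)) ρ)
    (hP : ContDiff ℝ 3 P) (hP3 : ∀ x ∈ K, ‖iteratedFDeriv ℝ 3 P x‖ ≤ c₃) {x : EuclideanSpace ℝ (Fin n)} (hx : x ∈ K) :
    ‖iteratedFDeriv ℝ 2 P x‖ ≤ ‖iteratedFDeriv ℝ 2 P 0‖ + c₃ * ρ := by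
  have hd : Differentiable ℝ (iteratedFDeriv ℝ 2 P) := hP.differentiable_iteratedFDeriv (by norm_num)
  have hb : ∀ z ∈ K, ‖fderiv ℝ (iteratedFDeriv ℝ 2 P) z‖ ≤ c₃ := fun z hz => by
    rw [norm_fderiv_iteratedFDeriv]; exact hP3 z hz
  have hmv := hK.norm_image_sub_le_of_norm_fderiv_le (fun z _ => (hd z)) hb h0 hx
  rw [sub_zero] at hmv
  have hxρ : ‖x‖ ≤ ρ := by simpa [mem_closedBall, dist_zero_right] using hKρ hx
  have hc₃ : 0 ≤ c₃ := (norm_nonneg _).trans (hP3 0 h0)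
  calc ‖iteratedFDeriv ℝ 2 P x‖ = ‖iteratedFDeriv ℝ 2 P 0 + (iteratedFDeriv ℝ 2 P x - iteratedFDeriv ℝ 2 P 0)‖ := by
        rw [add_sub_cancel]
    _ ≤ ‖iteratedFDeriv ℝ 2 P 0‖ + ‖iteratedFDeriv ℝ 2 P x - iteratedFDeriv ℝ 2 P 0‖ := norm_add_le _ _
    _ ≤ ‖iteratedFDeriv ℝ 2 P 0‖ + c₃ * ρ := by
        refine add_le_add le_rfl (hmv.trans ?_)
        exact mul_le_mul_of_nonneg_left hxρ hc₃

/-- **THE HESSIAN LOWER BOUND ON THE WINDOW FROM A THIRD-DERIVATIVE BOUND**: under the hypotheses of `norm_hessian_le_of_thirdDeriv_le`,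
`D²P(x)[v, v] ≥ −(‖D²P(0)‖ + c₃ρ)·‖v‖²` for `x ∈ K`. [folklore] -/
theorem hessianOn_lower_of_thirdDeriv_le {P : EuclideanSpace ℝ (Fin n) → ℝ} {c₃ ρ : ℝ} {K : Set (EuclideanSpace ℝ (Fin n))}
    (hK : Convex ℝ K) (h0 : (0 : EuclideanSpace ℝ (Fin n)) ∈ K) (hKρ : K ⊆ closedBall (0 : EuclideanSpace ℝ (Fin n)) ρ)
    (hP : ContDiff ℝ 3 P) (hP3 : ∀ x ∈ K, ‖iteratedFDeriv ℝ 3 P x‖ ≤ c₃) :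
    ∀ x ∈ K, ∀ v : EuclideanSpace ℝ (Fin n),
      -(‖iteratedFDeriv ℝ 2 P 0‖ + c₃ * ρ) * ‖v‖ ^ 2 ≤ iteratedFDeriv ℝ 2 P x ![v, v] := by
  intro x hx v
  have hn := norm_hessian_le_of_thirdDeriv_le hK h0 hKρ hP hP3 hx
  have hop := (iteratedFDeriv ℝ 2 P x).le_opNorm ![v, v]
  simp only [Fin.prod_univ_two, Matrix.cons_val_zero, Matrix.cons_val_one, Real.norm_eq_abs] at hop
  have h1 : |iteratedFDeriv ℝ 2 P x ![v, v]| ≤ (‖iteratedFDeriv ℝ 2 P 0‖ + c₃ * ρ) * ‖v‖ ^ 2 := by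
    calc |iteratedFDeriv ℝ 2 P x ![v, v]| ≤ ‖iteratedFDeriv ℝ 2 P x‖ * (‖v‖ * ‖v‖) := hop
      _ ≤ (‖iteratedFDeriv ℝ 2 P 0‖ + c₃ * ρ) * (‖v‖ * ‖v‖) := mul_le_mul_of_nonneg_right hn (by positivity)
      _ = (‖iteratedFDeriv ℝ 2 P 0‖ + c₃ * ρ) * ‖v‖ ^ 2 := by ring
  have h2 := (abs_le.1 h1).1
  linarith

/-- **THE CONVEXITY LETTER ON THE WINDOW FROM THREE PRIMITIVE CONSTANTS.**  `K` convex with `0 ∈ K ⊆ B̄(0, ρ)`; `A` symmetric with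
`⟪v, Av⟫ ≥ σ‖v‖²`; `P ∈ C³` with `‖D³P(x)‖ ≤ c₃` for `x ∈ K`.  Then `V = ⟪·, A·⟫ + P` satisfies the road's first-order letter ON `K` with
modulus `λ = 2σ − (‖D²P(0)‖ + c₃ρ)` — `= 2σ − c₃ρ` for an anharmonic remainder (`D²P(0) = 0`): the window's radius times the third
derivative is the only loss against the Gaussian modulus. [folklore] -/
theorem firstOrderOn_quadratic_add_of_thirdDeriv (A : EuclideanSpace ℝ (Fin n) →L[ℝ] EuclideanSpace ℝ (Fin n)) {σ c₃ ρ : ℝ}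
    {K : Set (EuclideanSpace ℝ (Fin n))} (hK : Convex ℝ K) (h0 : (0 : EuclideanSpace ℝ (Fin n)) ∈ K)
    (hKρ : K ⊆ closedBall (0 : EuclideanSpace ℝ (Fin n)) ρ)
    (hA : ∀ v w : EuclideanSpace ℝ (Fin n), ⟪A v, w⟫ = ⟪v, A w⟫) (hσ : ∀ v : EuclideanSpace ℝ (Fin n), σ * ‖v‖ ^ 2 ≤ ⟪v, A v⟫)
    {P : EuclideanSpace ℝ (Fin n) → ℝ} (hP : ContDiff ℝ 3 P) (hP3 : ∀ x ∈ K, ‖iteratedFDeriv ℝ 3 P x‖ ≤ c₃) :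
    ∀ x ∈ K, ∀ y ∈ K, (⟪x, A x⟫ + P x) + ⟪gradient (fun z : EuclideanSpace ℝ (Fin n) => ⟪z, A z⟫ + P z) x, y - x⟫ +
        (2 * σ - (‖iteratedFDeriv ℝ 2 P 0‖ + c₃ * ρ)) / 2 * ‖y - x‖ ^ 2 ≤ ⟪y, A y⟫ + P y :=
  firstOrderOn_quadratic_add_of_hessianOn A hK hA hσ (hP.of_le (by norm_num))
    (hessianOn_lower_of_thirdDeriv_le hK h0 hKρ hP hP3)

/-- The anharmonic case `D²P(0) = 0`: modulus `2σ − c₃ρ` ON `K`. [folklore] -/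
theorem firstOrderOn_quadratic_add_of_thirdDeriv_anharmonic (A : EuclideanSpace ℝ (Fin n) →L[ℝ] EuclideanSpace ℝ (Fin n))
    {σ c₃ ρ : ℝ} {K : Set (EuclideanSpace ℝ (Fin n))} (hK : Convex ℝ K) (h0 : (0 : EuclideanSpace ℝ (Fin n)) ∈ K)
    (hKρ : K ⊆ closedBall (0 : EuclideanSpace ℝ (Fin n)) ρ)
    (hA : ∀ v w : EuclideanSpace ℝ (Fin n), ⟪A v, w⟫ = ⟪v, A w⟫) (hσ : ∀ v : EuclideanSpace ℝ (Fin n), σ * ‖v‖ ^ 2 ≤ ⟪v, A v⟫)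
    {P : EuclideanSpace ℝ (Fin n) → ℝ} (hP : ContDiff ℝ 3 P) (hP2 : iteratedFDeriv ℝ 2 P 0 = 0)
    (hP3 : ∀ x ∈ K, ‖iteratedFDeriv ℝ 3 P x‖ ≤ c₃) :
    ∀ x ∈ K, ∀ y ∈ K, (⟪x, A x⟫ + P x) + ⟪gradient (fun z : EuclideanSpace ℝ (Fin n) => ⟪z, A z⟫ + P z) x, y - x⟫ +
        (2 * σ - c₃ * ρ) / 2 * ‖y - x‖ ^ 2 ≤ ⟪y, A y⟫ + P y := by
  have h := firstOrderOn_quadratic_add_of_thirdDeriv A hK h0 hKρ hA hσ hP hP3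
  rw [hP2, norm_zero, zero_add] at h
  exact h

end Summit.QuantumFields.BalabanUV.T4Continuum.NE7b.ConvexWindowSuppliers

end
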